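import Summits.QuantumFields.BalabanUV.T4Continuum.Support.NE7ClassPoincareLinesGeneric
import Summits.QuantumFields.BalabanUV.T4Continuum.Support.NE7EnergyBlockLandauPoincare
import HarnessLib

/-!
# NE7EnergyClassPoincareGeneric — THE CLASS PACKAGE FOR EVERY UNITARY GAUGE GROUP `U(n)`, EVERY BLOCK SIZE `L ≥ 2` AND EVERY DIMENSION `d ≥ 3`: one class radius `θ₀` and two
# constants `C_F, C_E` (depending on `d, L, card n` only) with, for every class radius `ε ≤ θ₀`: the level family `LevelSmall d L k (ε∕(L^{k+1})²)` (all `k`), the two class-smallness lines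
# `16·C₀(d)·ε ≤ 3`, `1024(d+1)(d+4)L²·ε ≤ 1`, the class slice-Poincaré inequality (P♮)_W of the frame-free block-Landau slice `T_♮(W)` (constant `C_F`) AND of the corner-free energy
# block-Landau slice `𝒯_E(W)` (constant `C_E`) on `sfClass d L N ε (j+1)` — the ONE group∕block-size-specific input of the whole NE3∕NE7 minimiser chain (there at `card n ∈ {2,3}`,
# `L = 2`, radius `10⁻⁵³`, by `norm_num`) is now a theorem for all `(d, L, n)`

Cell `pub-balaban`, rung (B)+1 sub-cell t4, lineage `b2b-balaban-t4-ne7-p1`, generation 109 (CRUX PROVER NE7 #1 = OWNER of BINDER row NE7).  Memo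
`t4/b2b-balaban-t4-ne7-p1-g109/ROAD-G109.md` §1–§3 (§3 = the PORT MAP: every `…SU2…`∕`L = 2` END of the chain becomes an instance of its generic core fed with THIS package).
WHAT ([folklore]; 0 def, 0 sorry).
* `levelSmall_all_of_lines` — `LevelSmall d L k (ε∕(L^{k+1})²)` for EVERY `k` from the two class-radius lines `16·14464(d+1)²(d+4)²·ε ≤ 3`, `2·twoLevelSmall d L·ε ≤ L²`
  (row NE3-R2's `levelSmall_of_small`; the `L = 2` record `NE7ConvOneStepSU2.levelSmall_all_d4_L2` is the instance `ε ≤ 10⁻¹¹`).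
* **`classPackage`**: `3 ≤ d`, `2 ≤ L`, ANY `n` ⟹ `∃ θ₀ C_F C_E`, `0 < θ₀ ≤ 10⁻¹¹`, `0 < C_F`, `0 ≤ C_E`, the two class-smallness lines at `θ₀`, and for every `0 ≤ ε ≤ θ₀`: the level
  family; for every `N ≥ 1`, `0 < ε ≤ θ₀`, `j`, `W ∈ sfClass d L N ε (j+1)`: (P♮)_W on `frameFreeBlockLandauW` with `C_F` and on `energyBlockLandauW` with `C_E`.
  Proof = THIS generation's `NE7ClassPoincareLinesGeneric.classSlicePoincare_generic` (soft existence of the four k-free lines) + gen 99's transfer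
  `NE7EnergyBlockLandauPoincare.slicePoincare_energyBlockLandauW_of_frameFree` (any `d, L, n`) with K6-Ξ by row NE3-R2's `xi_of_line` and the absorption line
  `32·card n·#Plane·C_F·ε² ≤ 1∕2` met by shrinking the radius; `C_F = CPLine d L (card n) εc θ + 1`, `C_E = 4·card n·C_F`.
* `classSlicePoincare_energyBlockLandau_generic` (the `𝒯_E` clause alone) and `classSlicePoincare_energyBlockLandau_generic_d4_L2` (the `d = 4`, `L = 2` instance in the letter
  shape gen 105's `NE7EnergyRateWGeneric.ne3EnergyRateWSup_of_classPoincare` consumes).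
HONEST FRAMING (page 1): composition of landed kernel theorems of rows NE3∕NE3-R2 and of this lineage (gens 99, 109); constants EXISTENTIAL (no decimal values for general `(d, L, n)`);
nothing of Bałaban's asserted; (KL-B)∕T-E_w♯∕(8)∃ follow only through the downstream files; NE3∕NE7 NOT proved as spine nodes; spine 0∕9; finite T⁴ rung (B)+1 — NOT infinite volume,
NOT mass gap, NOT BetaPertH, NOT Clay (continuum YM on T⁴ ⇐ BetaPertH ∧ nine spine estimates).
-/

set_option autoImplicit false

namespace Summit.QuantumFields.BalabanUV.T4Continuum.NE7EnergyClassPoincareGeneric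

open Literature.MathematicalPhysics.QuantumFieldTheory.Balaban1983to89
open B7Prop1Explicit B7Prop2Explicit
open T4AveragingDeficitWall (IsUnitaryCfg SmallField Plane)
open T4AveragingDeficitWallBoundary (IsPeriodicCfg periodBox)
open AveragingDeficitTwoLevelPrep (twoLevelSmall)
open AveragingDeficitMultiLevelPrep (LevelSmall tower)
open NE3SlicePoincareBudgetLine (CPLine)
open NE3SlicePoincareShape (SlicePoincare slicePoincare_mono)
open NE3FrameFreeSliceW (frameFreeBlockLandauW)
open NE3ClassSlicePoincare (xi_of_line)
open NE3ClassRadiusFamily (levelSmall_of_small)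
open NE3EnergyRateWSupOfSlicePoincare (tower_eq_mul_pow)
open NE7MeanZeroGaugeSliceW (energyBlockLandauW)
open NE7EnergyBlockLandauPoincare (slicePoincare_energyBlockLandauW_of_frameFree)
open NE7ClassPoincareLinesGeneric (classSlicePoincare_generic)
open MinimalActionRate (sfClass)

noncomputable section

variable {n : Type*} [Fintype n] [DecidableEq n]

omit [Fintype n] [DecidableEq n] in
/-- **THE LEVEL FAMILY AT EVERY LEVEL** from the two class-radius lines: `2 ≤ L`, `0 ≤ ε`, `16·14464(d+1)²(d+4)²·ε ≤ 3`, `2·twoLevelSmall d L·ε ≤ L²` ⟹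
`∀ k, LevelSmall d L k (ε∕(L^{k+1})²)` (`(L²)^k·ε∕(L^{k+1})² = ε∕L²`, level-free; row NE3-R2's `levelSmall_of_small`). [folklore] -/
theorem levelSmall_all_of_lines {d L : ℕ} (hL : 2 ≤ L) {ε : ℝ} (hε : 0 ≤ ε)
    (h1 : 16 * (14464 * ((d : ℝ) + 1) ^ 2 * ((d : ℝ) + 4) ^ 2) * ε ≤ 3) (h2 : 2 * twoLevelSmall d L * ε ≤ (L : ℝ) ^ 2) :
    ∀ k : ℕ, LevelSmall d L k (ε / ((L : ℝ) ^ (k + 1)) ^ 2) := by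
  intro k
  have hL0 : (0 : ℝ) < L := by exact_mod_cast (show 0 < L by omega)
  have hL2pos : (0 : ℝ) < (L : ℝ) ^ 2 := by positivity
  have hx : 0 ≤ ε / ((L : ℝ) ^ (k + 1)) ^ 2 := by positivity
  have key : ((L : ℝ) ^ 2) ^ k * (ε / ((L : ℝ) ^ (k + 1)) ^ 2) = ε / (L : ℝ) ^ 2 := by
    have hne : ((L : ℝ) ^ (k + 1)) ^ 2 ≠ 0 := by positivity
    have hne2 : (L : ℝ) ^ 2 ≠ 0 := by positivity
    field_simp
    ring
  apply levelSmall_of_small hL k hx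
  · rw [key]
    have e : 14464 * ((d : ℝ) + 1) ^ 2 * ((d : ℝ) + 4) ^ 2 * (L : ℝ) ^ 2 * (8 / 3 * (ε / (L : ℝ) ^ 2))
        = 8 / 3 * (14464 * ((d : ℝ) + 1) ^ 2 * ((d : ℝ) + 4) ^ 2) * ε := by
      field_simp
    rw [e]
    linarith
  · rw [key]
    have e : 2 * twoLevelSmall d L * (ε / (L : ℝ) ^ 2) = (2 * twoLevelSmall d L * ε) / (L : ℝ) ^ 2 := by ring
    rw [e, div_le_one hL2pos]
    exact h2

/-- **THE CLASS PACKAGE — ANY `U(n)`, ANY `L ≥ 2`, ANY `d ≥ 3`** (statement in the file header). [folklore] -/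
theorem classPackage [Nonempty n] {d : ℕ} (hd : 3 ≤ d) {L : ℕ} (hL : 2 ≤ L) :
    ∃ θ₀ CF CE : ℝ, 0 < θ₀ ∧ θ₀ ≤ 1 / 10 ^ 11 ∧ 0 < CF ∧ 0 ≤ CE ∧
      16 * C0 d * θ₀ ≤ 3 ∧ 1024 * ((d : ℝ) + 1) * ((d : ℝ) + 4) * (L : ℝ) ^ 2 * θ₀ ≤ 1 ∧
      (∀ {ε : ℝ}, 0 ≤ ε → ε ≤ θ₀ → ∀ k : ℕ, LevelSmall d L k (ε / ((L : ℝ) ^ (k + 1)) ^ 2)) ∧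
      (∀ {N : ℕ}, 1 ≤ N → ∀ {ε : ℝ}, 0 < ε → ε ≤ θ₀ →
        ∀ j : ℕ, ∀ W : Site d → Fin d → (Matrix n n ℂ)ˣ, W ∈ sfClass d L N ε (j + 1) →
          SlicePoincare L (j + 1) W (frameFreeBlockLandauW L N (j + 1) W) CF (periodBox (d := d) (N * L ^ (j + 1)))) ∧
      (∀ {N : ℕ} [NeZero N], 1 ≤ N → ∀ {ε : ℝ}, 0 < ε → ε ≤ θ₀ →
        ∀ j : ℕ, ∀ W : Site d → Fin d → (Matrix n n ℂ)ˣ, W ∈ sfClass d L N ε (j + 1) →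
          SlicePoincare L (j + 1) W (energyBlockLandauW (d := d) (n := n) L N (j + 1) W) CE
            (periodBox (d := d) (N * L ^ (j + 1)))) := by
  have hd1 : 1 ≤ d := by omega
  have hL0 : (0 : ℝ) < L := by exact_mod_cast (show 0 < L by omega)
  obtain ⟨εc, θ, hεc, hθ, hθ1, hK6, hr1, hr2, hCP0, hP⟩ := classSlicePoincare_generic (n := n) hd hL
  -- the letters: `C_F = CPLine + 1 > 0`, `K` the absorption coefficient, `C_E = 4·card n·C_F`
  set CP : ℝ := CPLine d L (Fintype.card n) εc θ with hCPdef
  set CF : ℝ := CP + 1 with hCFdef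
  have hCF0 : 0 < CF := by rw [hCFdef]; linarith
  set K : ℝ := 32 * (Fintype.card n : ℝ) * (Fintype.card (Plane d) : ℝ) * CF with hKdef
  have hK0 : 0 ≤ K := by rw [hKdef]; positivity
  have hK1 : 0 < 2 * (1 + K) := by positivity
  have hC0 : 0 < C0 d := C0_pos d
  have hD0 : (0 : ℝ) < 1024 * ((d : ℝ) + 1) * ((d : ℝ) + 4) * (L : ℝ) ^ 2 := by positivity
  -- the class radius: below `θ`, `10⁻¹¹`, the absorption threshold and the two class-smallness thresholds
  set θ₀ : ℝ := min (min (min θ (1 / 10 ^ 11)) (1 / (2 * (1 + K)))) (min (3 / (16 * C0 d)) (1 / (1024 * ((d : ℝ) + 1) * ((d : ℝ) + 4) * (L : ℝ) ^ 2)))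
    with hθ₀def
  have hθ₀θ : θ₀ ≤ θ := (min_le_left _ _).trans ((min_le_left _ _).trans (min_le_left _ _))
  have hθ₀11 : θ₀ ≤ 1 / 10 ^ 11 := (min_le_left _ _).trans ((min_le_left _ _).trans (min_le_right _ _))
  have hθ₀K : θ₀ ≤ 1 / (2 * (1 + K)) := (min_le_left _ _).trans (min_le_right _ _)
  have hθ₀C : θ₀ ≤ 3 / (16 * C0 d) := (min_le_right _ _).trans (min_le_left _ _)
  have hθ₀D : θ₀ ≤ 1 / (1024 * ((d : ℝ) + 1) * ((d : ℝ) + 4) * (L : ℝ) ^ 2) := (min_le_right _ _).trans (min_le_right _ _)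
  have hθ₀pos : 0 < θ₀ := by
    rw [hθ₀def]
    refine lt_min (lt_min (lt_min hθ (by norm_num)) (by positivity)) (lt_min (by positivity) (by positivity))
  refine ⟨θ₀, CF, 4 * (Fintype.card n : ℝ) * CF, hθ₀pos, hθ₀11, hCF0, by positivity, ?_, ?_, ?_, ?_, ?_⟩
  · -- `16·C₀·θ₀ ≤ 3`
    have h := mul_le_mul_of_nonneg_left hθ₀C (show (0 : ℝ) ≤ 16 * C0 d by positivity)
    have e : 16 * C0 d * (3 / (16 * C0 d)) = 3 := by field_simp
    linarith [h, e]
  · -- `1024(d+1)(d+4)L²·θ₀ ≤ 1`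
    have h := mul_le_mul_of_nonneg_left hθ₀D hD0.le
    have e : 1024 * ((d : ℝ) + 1) * ((d : ℝ) + 4) * (L : ℝ) ^ 2 * (1 / (1024 * ((d : ℝ) + 1) * ((d : ℝ) + 4) * (L : ℝ) ^ 2)) = 1 := by
      field_simp
    linarith [h, e]
  · -- the level family
    intro ε hε0 hεθ₀ k
    have hεθ : ε ≤ θ := hεθ₀.trans hθ₀θ
    have hc₁ : (0 : ℝ) ≤ 16 * (14464 * ((d : ℝ) + 1) ^ 2 * ((d : ℝ) + 4) ^ 2) := by positivity
    have ht : (0 : ℝ) ≤ 2 * twoLevelSmall d L := by unfold twoLevelSmall; positivity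
    exact levelSmall_all_of_lines hL hε0 ((mul_le_mul_of_nonneg_left hεθ hc₁).trans hr1) ((mul_le_mul_of_nonneg_left hεθ ht).trans hr2) k
  · -- (P♮)_W on `T_♮` with the constant `C_F = CPLine + 1`
    intro N hN ε hε hεθ₀ j W hW
    exact slicePoincare_mono (hP hN hε (hεθ₀.trans hθ₀θ) j W hW) (by rw [hCFdef]; linarith)
  · -- (P♮)_W on `𝒯_E` by the transfer
    intro N _ hN ε hε hεθ₀ j W hW
    have hεθ : ε ≤ θ := hεθ₀.trans hθ₀θ
    have hεK : ε ≤ 1 / (2 * (1 + K)) := hεθ₀.trans hθ₀K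
    have hε1 : ε ≤ 1 := hεθ.trans hθ1
    obtain ⟨hWu, hWP, hWx⟩ := hW
    -- the level radius `x = ε∕(L^{j+1})²`
    set x : ℝ := ε / ((L : ℝ) ^ (j + 1)) ^ 2 with hxdef
    have hx : 0 ≤ x := by rw [hxdef]; positivity
    have hMx : ((L : ℝ) ^ (j + 1)) ^ 2 * x = ε := by
      rw [hxdef]; field_simp
    -- `LevelSmall d L j x`
    have hc₁ : (0 : ℝ) ≤ 16 * (14464 * ((d : ℝ) + 1) ^ 2 * ((d : ℝ) + 4) ^ 2) := by positivity
    have ht : (0 : ℝ) ≤ 2 * twoLevelSmall d L := by unfold twoLevelSmall; positivity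
    have hs : LevelSmall d L j x :=
      levelSmall_all_of_lines hL hε.le ((mul_le_mul_of_nonneg_left hεθ hc₁).trans hr1) ((mul_le_mul_of_nonneg_left hεθ ht).trans hr2) j
    -- the period in tower form
    have hNM : N * L ^ (j + 1) = tower L N (j + 1) := (tower_eq_mul_pow L N (j + 1)).symm
    have hWP' : IsPeriodicCfg W ((tower L N (j + 1) : ℕ) : ℤ) := by rw [← hNM]; exact hWP
    -- K6-Ξ at the level
    have hK6x := xi_of_line (d := d) hd1 (L := L) (c := Fintype.card n) hL j hx hs (θ := θ) (by rw [hMx]; exact hεθ) hK6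
    -- the absorption line
    have habs : 32 * (Fintype.card n : ℝ) * (Fintype.card (Plane d) : ℝ) * CF * ((((L : ℝ) ^ (j + 1)) ^ 2) * x) ^ 2 ≤ 1 / 2 := by
      rw [hMx]
      change K * ε ^ 2 ≤ 1 / 2
      have hε2 : ε ^ 2 ≤ ε := by nlinarith
      have h1 : K * ε ^ 2 ≤ K * (1 / (2 * (1 + K))) := mul_le_mul_of_nonneg_left (hε2.trans hεK) hK0
      have h2 : K * (1 / (2 * (1 + K))) ≤ 1 / 2 := by
        rw [← mul_div_assoc, mul_one, div_le_iff₀ hK1]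
        linarith
      exact h1.trans h2
    -- (P♮)_W on the frame-free slice with `C_F`, then the transfer to `𝒯_E`
    have hPW : SlicePoincare L (j + 1) W (frameFreeBlockLandauW L N (j + 1) W) CF (periodBox (d := d) (tower L N (j + 1))) := by
      rw [← hNM]
      exact slicePoincare_mono (hP hN hε hεθ j W ⟨hWu, hWP, hWx⟩) (by rw [hCFdef]; linarith)
    have hLd : 2 ≤ L ^ d := hL.trans (Nat.le_self_pow (by omega) L)
    have hT := slicePoincare_energyBlockLandauW_of_frameFree (d := d) (n := n) (N := N) (L := L) hL hLd j hWu hWP' hx hs hWx hK6x hCF0.le habs hPW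
    rw [hNM]
    exact hT

/-- **SLICE POINCARÉ FOR `𝒯_E(W)` ON THE WHOLE SMALL-FIELD CLASS — ANY `U(n)`, ANY `L ≥ 2`, ANY `d ≥ 3`** (the `𝒯_E` clause of `classPackage`). [folklore] -/
theorem classSlicePoincare_energyBlockLandau_generic [Nonempty n] {d : ℕ} (hd : 3 ≤ d) {L : ℕ} (hL : 2 ≤ L) :
    ∃ θ₀ CE : ℝ, 0 < θ₀ ∧ θ₀ ≤ 1 / 10 ^ 11 ∧ 0 ≤ CE ∧
      ∀ {N : ℕ} [NeZero N], 1 ≤ N → ∀ {ε : ℝ}, 0 < ε → ε ≤ θ₀ →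
        ∀ j : ℕ, ∀ W : Site d → Fin d → (Matrix n n ℂ)ˣ, W ∈ sfClass d L N ε (j + 1) →
          SlicePoincare L (j + 1) W (energyBlockLandauW (d := d) (n := n) L N (j + 1) W) CE
            (periodBox (d := d) (N * L ^ (j + 1))) := by
  obtain ⟨θ₀, CF, CE, hθ₀, hθ₀11, -, hCE, -, -, -, -, hE⟩ := classPackage (n := n) hd hL
  exact ⟨θ₀, CE, hθ₀, hθ₀11, hCE, hE⟩

/-- **THE `d = 4`, `L = 2` INSTANCE IN THE CONSUMER's LETTER SHAPE** (gen 105's `NE7EnergyRateWGeneric.ne3EnergyRateWSup_of_classPoincare` reads `hPclass` with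
`∀ N [NeZero N], 1 ≤ N → ∀ ε, 0 < ε → ε ≤ ε₁ → …`, `ε₁ ≤ 10⁻¹¹`, `periodBox (N * 2 ^ (j + 1))`): for ANY `n`. [folklore] -/
theorem classSlicePoincare_energyBlockLandau_generic_d4_L2 [Nonempty n] :
    ∃ ε₁ CE : ℝ, 0 < ε₁ ∧ ε₁ ≤ 1 / 10 ^ 11 ∧ 0 ≤ CE ∧
      ∀ (N : ℕ) [NeZero N], 1 ≤ N → ∀ ε : ℝ, 0 < ε → ε ≤ ε₁ → ∀ (j : ℕ) (W : Site 4 → Fin 4 → (Matrix n n ℂ)ˣ),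
        W ∈ sfClass 4 2 N ε (j + 1) →
          SlicePoincare 2 (j + 1) W (energyBlockLandauW (d := 4) (n := n) 2 N (j + 1) W) CE (periodBox (d := 4) (N * 2 ^ (j + 1))) := by
  obtain ⟨θ₀, CE, hθ₀, hθ₀11, hCE, H⟩ := classSlicePoincare_energyBlockLandau_generic (n := n) (d := 4) (by norm_num) (L := 2) (by norm_num)
  refine ⟨θ₀, CE, hθ₀, hθ₀11, hCE, ?_⟩
  intro N _ hN ε hε hεle j W hW
  exact H hN hε hεle j W hW

end

end Summit.QuantumFields.BalabanUV.T4Continuum.NE7EnergyClassPoincareGeneric
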